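/-
Copyright (c) 2026 the pub-hodgecm-mathlib formalisation cell (harness21).  Prover seat hodgecm-mathlib-R90-CS-p03 (g3), R90-TF section S8 «ContSpec-n½» (dealer R90-CS-plan (g3),
S8-R212 (2) «`K2E1ChiArchA32MovedBasePointU3` — `hA32_of_record_at_w₀`»; finding F-A32, repair (R1)): ★ F5's `hA32` for the amplitude of record READ AT THE MOVED BASE POINT
`g₁ := ι_f(w₀^{S₀})`, i.e. at the NAMED 𝔫-BALL TEST WEIGHTS `ω_v^{𝔫} = 𝟙{p ∈ 𝒪_v³ : |X_{w′}|, |σX_{w′}|, |Z_{w′}| ≤ |𝔫|_{w′} ∀ w′ ∣ v}` at the bad places — the ball of the (E-cell)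
criterion (★ p864267), which ★ (E-supp) p864219 turns into the witness's weight; composed from ★ p864169 `hA32_of_record_of_testWeights`.
-/
import Summits.HodgeConjecture.HodgeConjecture.Theorems.K2E1ChiArchA32FiniteHalfOfRecordU3   -- ★ p864169 (this seat): `hA32_of_record_of_testWeights`; brings ★ (a-4) (`localHeight_zero`, the local height currency, `integralBox`), ★ g2 `hA32_of_record`
import Literature.NumberTheory.Automorphic.FiniteAdeleFactorizable                        -- ★ `isClopen_setOf_valued_le` (closed valuation balls are clopen)
import Literature.NumberTheory.Automorphic.UnitaryGroupLocalIntegralMembership              -- ★ `normAbs_le_one_iff_valued` (`|a| ≤ 1 ↔ v a ≤ 1`)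
import Literature.NumberTheory.Automorphic.GJUnfoldingData                                  -- ★ `idealRadius_ne_zero`, brings ★ `idealRadius_le_one` (`|𝔫|_w ≤ 1`)
import HarnessLib

/-!
# K2·E1 ∕ R90·S8 — `K2E1ChiArchA32MovedBasePointU3`: ★ F5's `hA32` AT THE MOVED BASE POINT — THE 𝔫-BALL TEST WEIGHTS AT THE BAD PLACES

Cell `pub/hodgecm-mathlib`, crux h413 = `stmt-HodgeConjecture-24833`, route of record `HCCMUnconditional`; R90-TF section S8 «ContSpec-n½», road R2-χ₃ ((V) OF RECORD row (iii) `hA32`;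
structural finding F-A32 and its repair (R1) «read the intertwined witness at `g₁ := ι_f(w₀^{S₀})`»).  THEOREMS ONLY (no `def`, no `instance`, no notation, no named-fact hypothesis, no
`sorry`; default heartbeats); lane `--supports stmt-HodgeConjecture-24833 --as helper` (count-neutral).  Closes no socket.

THE MATHEMATICS ([MoeglinWaldspurger1995] II.1.6–II.1.7, IV.1.11; [Rogawski1990] §4.5, §13.9 p. 229; [Casselman1980] §3).  For an ideal `𝔫` of `𝓞_L` and a finite place `v` of `L⁺`, the
**𝔫-BALL** in the base coordinates `p = (a, b, t) ∈ (L⁺_v)³` of the S8 chain (`X(p) = Ψ_v(a,b) ∈ ∏_{w′∣v} L_{w′}`, `Z(p) = ι t·δ − ½·X·σX`) is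
`B_v(𝔫) := {p ∈ 𝒪_v³ : ∀ w′ ∣ v, v(X_{w′}) ≤ |𝔫|_{w′} ∧ v(σX_{w′}) ≤ |𝔫|_{w′} ∧ v(Z_{w′}) ≤ |𝔫|_{w′}}` (`|𝔫|_{w′}` = ★ `idealRadius L w′ 𝔫`).  It is OPEN (the coordinates are continuous, closed
valuation balls are clopen ★ `isClopen_setOf_valued_le`, `𝒪_v³` is open ★), contains `0`, lies in the compact `𝒪_v³`, so `0 < ν_v³(B_v(𝔫)) < ∞`; and since `|𝔫|_{w′} ≤ 1` the local
height `Q_v(p) = ∏_{w′} max(1, ‖X_{w′}‖, ‖Z_{w′}‖)` is `1` on it.  Hence the indicator weight `ω_v^{𝔫} := 𝟙_{B_v(𝔫)}` is a TEST WEIGHT in the sense of ★ (a-4) ∕ ★ p864169 (`c_v = 1`), and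
★ `hA32_of_record_of_testWeights` gives ★ F5's `hA32` for the amplitude `A z := (C·∏_{v∈S₀} m_v^{𝔫}(z))·∫∫(u·∏_w archUnitaryValue (m_w) 0 ζ_w)·ARCH₃^{−z}` with
`m_v^{𝔫}(z) = ν_v(𝒪_v³)⁻¹ • ∫ 𝟙_{B_v(𝔫)}·Q_v^{−z}` — NO divisibility hypothesis on `𝔫` is needed for this.  WHY THIS BALL (F-A32 (R1)): by ★ (E-cell)
`K2E1BigCellConjugateCongruenceU3.lowerUnitriangular_mem_borel_mul_valuedCongruence_iff` (radius `|𝔫|_{w′} < 1`, i.e. `w′ ∣ 𝔫`), `w₀·u(X,Z)·w₀ = n⁻(X,Z) ∈ B_v·K_v(𝔫)` iff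
`v(σX), v(Z), v(X) ≤ |𝔫|`, and by ★ (E-supp) `exists_finLevelSection_with_support` the finite-level witness section is `θ(1) = 1` there and `0` off `B_f·K_f(𝔫)`: so AT A LEVEL DIVISIBLE BY
EVERY PLACE OF `S₀` the witness read at the base point `ι_f(w₀^{S₀})` has exactly the weights `ω_v^{𝔫}` — that identification is the supplier's unfolding row (`hUNF`∕`hsrc`), not this file.
RECOMMENDATION for (V) OF RECORD ED. 4: `𝔫 := 𝔫_cond · ∏_{v∈S₀} ∏_{w′∣v} 𝔭_{w′}` (any multiple of the conductor level satisfies ★ FILE 2's `hKχ`; the extra factor makes `|𝔫|_{w′} < 1` over `S₀`).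
* §1 the 𝔫-ball: `isOpen_levelBall`, `zero_mem_levelBall`, `levelBall_subset_integralBox`, `measurableSet_levelBall`, `levelBall_measure_pos`, `levelBall_measure_lt_top`,
  `localHeight_eq_one_of_mem_levelBall`.
* §2 HEAD **`hA32_of_record_at_basePoint`** — ★ F5's `A (3 / 2) ≠ 0` for the amplitude with the 𝔫-ball weights at `S₀`; visible letters exactly {`hm : ∀ w, |m w| ≤ 2`, `hu : u ≠ 0`,
  `hC : C ≠ 0`} (arch letters ★ on the unit-coupling blocks by p864144; `C > 0` from ★ (a-2b)).
HONEST LABEL: HC_CM is proved only modulo the 7 printed citations (2 remaining named inputs: hLiu418 = `stmt-HodgeConjecture-24832`, h413 = `stmt-HodgeConjecture-24833`) until rung 0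
closes; REL ≠ ★ ≠ BUILT; this file asserts no named fact and closes no socket; the identification of `ω_v^{𝔫}` with the witness's weight lives in the unfolding row; count-neutral.

## References
* [MoeglinWaldspurger1995] C. Mœglin, J.-L. Waldspurger, *Spectral Decomposition and Eisenstein Series* (1995): II.1.6, II.1.7, IV.1.11.
* [Rogawski1990] J. D. Rogawski, *Automorphic Representations of Unitary Groups in Three Variables*, Ann. of Math. Stud. 123 (1990): §4.5, §13.9 p. 229.
* [Casselman1980] W. Casselman, *The unramified principal series of p-adic groups I*, Compositio Math. 40 (1980): §3.
* [TateThesis1967] J. Tate, *Fourier analysis in number fields and Hecke's zeta-functions* (1967): §3.3.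
-/

set_option autoImplicit false
set_option linter.dupNamespace false -- the mandated namespace repeats `HodgeConjecture.HodgeConjecture`

noncomputable section

open MeasureTheory MeasureTheory.Measure NumberField NumberField.InfinitePlace IsDedekindDomain Filter Set
open scoped NNReal ENNReal
open Literature.NumberTheory.Automorphic Literature.NumberTheory.Automorphic.UnitaryGroup Literature.NumberTheory.GaloisRepresentations
open Literature.NumberTheory.GaloisRepresentations (archUnitaryValue)
open Literature.NumberTheory.GaloisRepresentations.IsNonarchimedeanLocalField
open Summit.HodgeConjecture.HodgeConjecture.Cruxes.H413
open Summit.HodgeConjecture.HodgeConjecture.Cruxes.H413.K2E1ChiLocalMeanTestWeightU3 (localHeight_zero)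
open Summit.HodgeConjecture.HodgeConjecture.Cruxes.H413.K2E1ChiArchA32FiniteHalfOfRecordU3 (hA32_of_record_of_testWeights)

namespace Summit.HodgeConjecture.HodgeConjecture.Cruxes.H413.K2E1ChiArchA32MovedBasePointU3

variable (L : Type) [Field L] [NumberField L] [IsCMField L] {δ : L} (hcδ : IsCMField.complexConj L δ = -δ) (hδ : δ ≠ 0)
  (v : HeightOneSpectrum (𝓞 ↥(maximalRealSubfield L))) (𝔫 : Ideal (𝓞 L))

/-! ## §1 The 𝔫-ball at a finite place: open, `∋ 0`, inside `𝒪_v³`, of positive finite volume, local height `1` -/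

/-- The three coordinate maps `p ↦ X(p)_{w′}`, `p ↦ σX(p)_{w′}`, `p ↦ Z(p)_{w′}` are continuous (`Ψ_v`, `ι`, `σ = c ⊗ 1` are continuous ring maps). [cite: TateThesis1967, §3.3] -/
theorem continuous_coordinates (w' : PlacesOver L v) :
    Continuous (fun p : Fin 3 → v.adicCompletion ↥(maximalRealSubfield L) => quadraticLocalEquiv L v (IsCMField.complexConj L) hcδ hδ (p 0, p 1) w') ∧
    Continuous (fun p : Fin 3 → v.adicCompletion ↥(maximalRealSubfield L) => conjLocal L (IsCMField.complexConj L) v (quadraticLocalEquiv L v (IsCMField.complexConj L) hcδ hδ (p 0, p 1)) w') ∧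
    Continuous (fun p : Fin 3 → v.adicCompletion ↥(maximalRealSubfield L) => (toLocalRing L v (p 2) * algebraMap L (LocalRing L v) δ -
      toLocalRing L v 2⁻¹ * (quadraticLocalEquiv L v (IsCMField.complexConj L) hcδ hδ (p 0, p 1) * conjLocal L (IsCMField.complexConj L) v (quadraticLocalEquiv L v (IsCMField.complexConj L) hcδ hδ (p 0, p 1)))) w') := by
  have hΨ : Continuous fun p : Fin 3 → v.adicCompletion ↥(maximalRealSubfield L) => quadraticLocalEquiv L v (IsCMField.complexConj L) hcδ hδ (p 0, p 1) :=
    (quadraticLocalEquiv L v (IsCMField.complexConj L) hcδ hδ).continuous.comp ((continuous_apply 0).prodMk (continuous_apply 1))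
  have hσΨ : Continuous fun p : Fin 3 → v.adicCompletion ↥(maximalRealSubfield L) => conjLocal L (IsCMField.complexConj L) v (quadraticLocalEquiv L v (IsCMField.complexConj L) hcδ hδ (p 0, p 1)) :=
    (continuous_conjLocal L (IsCMField.complexConj L) v).comp hΨ
  have hZ : Continuous fun p : Fin 3 → v.adicCompletion ↥(maximalRealSubfield L) => toLocalRing L v (p 2) * algebraMap L (LocalRing L v) δ -
      toLocalRing L v 2⁻¹ * (quadraticLocalEquiv L v (IsCMField.complexConj L) hcδ hδ (p 0, p 1) * conjLocal L (IsCMField.complexConj L) v (quadraticLocalEquiv L v (IsCMField.complexConj L) hcδ hδ (p 0, p 1))) :=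
    (((continuous_toLocalRing L v).comp (continuous_apply 2)).mul continuous_const).sub (continuous_const.mul (hΨ.mul hσΨ))
  exact ⟨(continuous_apply w').comp hΨ, (continuous_apply w').comp hσΨ, (continuous_apply w').comp hZ⟩

/-- **THE 𝔫-BALL IS OPEN**: `𝒪_v³` is open (★ `isOpen_integralBox`) and each valuation condition is the preimage of a clopen valuation ball (★ `isClopen_setOf_valued_le`, radius
`|𝔫|_{w′} ≠ 0`) under a continuous coordinate. [cite: TateThesis1967, §3.3] -/
theorem isOpen_levelBall :
    IsOpen {p : Fin 3 → v.adicCompletion ↥(maximalRealSubfield L) | p ∈ integralBox ↥(maximalRealSubfield L) (Fin 3) v ∧ ∀ w' : PlacesOver L v,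
      Valued.v (quadraticLocalEquiv L v (IsCMField.complexConj L) hcδ hδ (p 0, p 1) w') ≤ idealRadius L w'.1 𝔫 ∧
      Valued.v (conjLocal L (IsCMField.complexConj L) v (quadraticLocalEquiv L v (IsCMField.complexConj L) hcδ hδ (p 0, p 1)) w') ≤ idealRadius L w'.1 𝔫 ∧
      Valued.v ((toLocalRing L v (p 2) * algebraMap L (LocalRing L v) δ -
        toLocalRing L v 2⁻¹ * (quadraticLocalEquiv L v (IsCMField.complexConj L) hcδ hδ (p 0, p 1) * conjLocal L (IsCMField.complexConj L) v (quadraticLocalEquiv L v (IsCMField.complexConj L) hcδ hδ (p 0, p 1)))) w') ≤ idealRadius L w'.1 𝔫} := by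
  simp only [Set.setOf_and, Set.setOf_forall]
  refine (isOpen_integralBox ↥(maximalRealSubfield L) (Fin 3) v).inter (isOpen_iInter_of_finite fun w' => ?_)
  obtain ⟨h1, h2, h3⟩ := continuous_coordinates L hcδ hδ v w'
  have hball : IsOpen {y : w'.1.adicCompletion L | Valued.v y ≤ idealRadius L w'.1 𝔫} := (isClopen_setOf_valued_le L w'.1 (idealRadius_ne_zero w'.1 𝔫)).isOpen
  exact (hball.preimage h1).inter ((hball.preimage h2).inter (hball.preimage h3))

/-- **`0` LIES IN THE 𝔫-BALL** (`X(0) = 0`, `σX(0) = 0`, `Z(0) = 0`, `0 ∈ 𝒪_v³`). [folklore] -/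
theorem zero_mem_levelBall :
    (0 : Fin 3 → v.adicCompletion ↥(maximalRealSubfield L)) ∈ {p : Fin 3 → v.adicCompletion ↥(maximalRealSubfield L) | p ∈ integralBox ↥(maximalRealSubfield L) (Fin 3) v ∧ ∀ w' : PlacesOver L v,
      Valued.v (quadraticLocalEquiv L v (IsCMField.complexConj L) hcδ hδ (p 0, p 1) w') ≤ idealRadius L w'.1 𝔫 ∧
      Valued.v (conjLocal L (IsCMField.complexConj L) v (quadraticLocalEquiv L v (IsCMField.complexConj L) hcδ hδ (p 0, p 1)) w') ≤ idealRadius L w'.1 𝔫 ∧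
      Valued.v ((toLocalRing L v (p 2) * algebraMap L (LocalRing L v) δ -
        toLocalRing L v 2⁻¹ * (quadraticLocalEquiv L v (IsCMField.complexConj L) hcδ hδ (p 0, p 1) * conjLocal L (IsCMField.complexConj L) v (quadraticLocalEquiv L v (IsCMField.complexConj L) hcδ hδ (p 0, p 1)))) w') ≤ idealRadius L w'.1 𝔫} := by
  refine ⟨zero_mem_integralBox ↥(maximalRealSubfield L) (Fin 3) v, fun w' => ?_⟩
  have hX : quadraticLocalEquiv L v (IsCMField.complexConj L) hcδ hδ ((0 : v.adicCompletion ↥(maximalRealSubfield L)), (0 : v.adicCompletion ↥(maximalRealSubfield L))) = 0 := by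
    rw [Prod.mk_zero_zero, map_zero]
  simp only [Pi.zero_apply, hX, map_zero, zero_mul, mul_zero, sub_self, zero_le, and_self]

/-- The 𝔫-ball lies in `𝒪_v³` (by definition). [folklore] -/
theorem levelBall_subset_integralBox :
    {p : Fin 3 → v.adicCompletion ↥(maximalRealSubfield L) | p ∈ integralBox ↥(maximalRealSubfield L) (Fin 3) v ∧ ∀ w' : PlacesOver L v,
      Valued.v (quadraticLocalEquiv L v (IsCMField.complexConj L) hcδ hδ (p 0, p 1) w') ≤ idealRadius L w'.1 𝔫 ∧
      Valued.v (conjLocal L (IsCMField.complexConj L) v (quadraticLocalEquiv L v (IsCMField.complexConj L) hcδ hδ (p 0, p 1)) w') ≤ idealRadius L w'.1 𝔫 ∧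
      Valued.v ((toLocalRing L v (p 2) * algebraMap L (LocalRing L v) δ -
        toLocalRing L v 2⁻¹ * (quadraticLocalEquiv L v (IsCMField.complexConj L) hcδ hδ (p 0, p 1) * conjLocal L (IsCMField.complexConj L) v (quadraticLocalEquiv L v (IsCMField.complexConj L) hcδ hδ (p 0, p 1)))) w') ≤ idealRadius L w'.1 𝔫} ⊆
      integralBox ↥(maximalRealSubfield L) (Fin 3) v := fun _ hp => hp.1

/-- **`Q_v = 1` ON THE 𝔫-BALL**: `|𝔫|_{w′} ≤ 1` (★ `idealRadius_le_one`), so every coordinate has `‖·‖_{w′} ≤ 1` (★ `normAbs_le_one_iff_valued`) and each factor `max(1, ‖X_{w′}‖, ‖Z_{w′}‖)` of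
the local height is `1`. [cite: MoeglinWaldspurger1995, II.1.6] [cite: TateThesis1967, §3.3] -/
theorem localHeight_eq_one_of_mem_levelBall {p : Fin 3 → v.adicCompletion ↥(maximalRealSubfield L)}
    (hp : p ∈ {p : Fin 3 → v.adicCompletion ↥(maximalRealSubfield L) | p ∈ integralBox ↥(maximalRealSubfield L) (Fin 3) v ∧ ∀ w' : PlacesOver L v,
      Valued.v (quadraticLocalEquiv L v (IsCMField.complexConj L) hcδ hδ (p 0, p 1) w') ≤ idealRadius L w'.1 𝔫 ∧
      Valued.v (conjLocal L (IsCMField.complexConj L) v (quadraticLocalEquiv L v (IsCMField.complexConj L) hcδ hδ (p 0, p 1)) w') ≤ idealRadius L w'.1 𝔫 ∧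
      Valued.v ((toLocalRing L v (p 2) * algebraMap L (LocalRing L v) δ -
        toLocalRing L v 2⁻¹ * (quadraticLocalEquiv L v (IsCMField.complexConj L) hcδ hδ (p 0, p 1) * conjLocal L (IsCMField.complexConj L) v (quadraticLocalEquiv L v (IsCMField.complexConj L) hcδ hδ (p 0, p 1)))) w') ≤ idealRadius L w'.1 𝔫}) :
    (∏ w' : PlacesOver L v, max 1 (max ((normAbs (w'.1.adicCompletion L) (quadraticLocalEquiv L v (IsCMField.complexConj L) hcδ hδ (p 0, p 1) w') : ℝ≥0) : ℝ)
        ((normAbs (w'.1.adicCompletion L) ((toLocalRing L v (p 2) * algebraMap L (LocalRing L v) δ -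
          toLocalRing L v 2⁻¹ * (quadraticLocalEquiv L v (IsCMField.complexConj L) hcδ hδ (p 0, p 1) *
            conjLocal L (IsCMField.complexConj L) v (quadraticLocalEquiv L v (IsCMField.complexConj L) hcδ hδ (p 0, p 1)))) w') : ℝ≥0) : ℝ))) = 1 := by
  refine Finset.prod_eq_one fun w' _ => ?_
  obtain ⟨hX, -, hZ⟩ := hp.2 w'
  have h1 := idealRadius_le_one L w'.1 𝔫
  have hX1 : ((normAbs (w'.1.adicCompletion L) (quadraticLocalEquiv L v (IsCMField.complexConj L) hcδ hδ (p 0, p 1) w') : ℝ≥0) : ℝ) ≤ 1 := by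
    exact_mod_cast (normAbs_le_one_iff_valued w'.1 _).2 (hX.trans h1)
  have hZ1 : ((normAbs (w'.1.adicCompletion L) ((toLocalRing L v (p 2) * algebraMap L (LocalRing L v) δ -
          toLocalRing L v 2⁻¹ * (quadraticLocalEquiv L v (IsCMField.complexConj L) hcδ hδ (p 0, p 1) *
            conjLocal L (IsCMField.complexConj L) v (quadraticLocalEquiv L v (IsCMField.complexConj L) hcδ hδ (p 0, p 1)))) w') : ℝ≥0) : ℝ) ≤ 1 := by
    exact_mod_cast (normAbs_le_one_iff_valued w'.1 _).2 (hZ.trans h1)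
  exact max_eq_left (max_le hX1 hZ1)

section Measure

variable [MeasurableSpace (v.adicCompletion ↥(maximalRealSubfield L))] [BorelSpace (v.adicCompletion ↥(maximalRealSubfield L))] (νv : Measure (v.adicCompletion ↥(maximalRealSubfield L))) [νv.IsAddHaarMeasure]

/-- The 𝔫-ball is measurable (open). [folklore] -/
theorem measurableSet_levelBall :
    MeasurableSet {p : Fin 3 → v.adicCompletion ↥(maximalRealSubfield L) | p ∈ integralBox ↥(maximalRealSubfield L) (Fin 3) v ∧ ∀ w' : PlacesOver L v,
      Valued.v (quadraticLocalEquiv L v (IsCMField.complexConj L) hcδ hδ (p 0, p 1) w') ≤ idealRadius L w'.1 𝔫 ∧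
      Valued.v (conjLocal L (IsCMField.complexConj L) v (quadraticLocalEquiv L v (IsCMField.complexConj L) hcδ hδ (p 0, p 1)) w') ≤ idealRadius L w'.1 𝔫 ∧
      Valued.v ((toLocalRing L v (p 2) * algebraMap L (LocalRing L v) δ -
        toLocalRing L v 2⁻¹ * (quadraticLocalEquiv L v (IsCMField.complexConj L) hcδ hδ (p 0, p 1) * conjLocal L (IsCMField.complexConj L) v (quadraticLocalEquiv L v (IsCMField.complexConj L) hcδ hδ (p 0, p 1)))) w') ≤ idealRadius L w'.1 𝔫} := by
  haveI : SecondCountableTopology (v.adicCompletion ↥(maximalRealSubfield L)) := secondCountableTopology_localField _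
  exact (isOpen_levelBall L hcδ hδ v 𝔫).measurableSet

omit [BorelSpace (v.adicCompletion ↥(maximalRealSubfield L))] in
/-- **THE 𝔫-BALL HAS POSITIVE VOLUME** (open, `∋ 0`; Haar measures charge open sets). [cite: TateThesis1967, §3.3] -/
theorem levelBall_measure_pos [BorelSpace (v.adicCompletion ↥(maximalRealSubfield L))] :
    0 < (Measure.pi fun _ : Fin 3 => νv) {p : Fin 3 → v.adicCompletion ↥(maximalRealSubfield L) | p ∈ integralBox ↥(maximalRealSubfield L) (Fin 3) v ∧ ∀ w' : PlacesOver L v,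
      Valued.v (quadraticLocalEquiv L v (IsCMField.complexConj L) hcδ hδ (p 0, p 1) w') ≤ idealRadius L w'.1 𝔫 ∧
      Valued.v (conjLocal L (IsCMField.complexConj L) v (quadraticLocalEquiv L v (IsCMField.complexConj L) hcδ hδ (p 0, p 1)) w') ≤ idealRadius L w'.1 𝔫 ∧
      Valued.v ((toLocalRing L v (p 2) * algebraMap L (LocalRing L v) δ -
        toLocalRing L v 2⁻¹ * (quadraticLocalEquiv L v (IsCMField.complexConj L) hcδ hδ (p 0, p 1) * conjLocal L (IsCMField.complexConj L) v (quadraticLocalEquiv L v (IsCMField.complexConj L) hcδ hδ (p 0, p 1)))) w') ≤ idealRadius L w'.1 𝔫} := by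
  haveI : SecondCountableTopology (v.adicCompletion ↥(maximalRealSubfield L)) := secondCountableTopology_localField _
  exact (isOpen_levelBall L hcδ hδ v 𝔫).measure_pos _ ⟨0, zero_mem_levelBall L hcδ hδ v 𝔫⟩

omit [BorelSpace (v.adicCompletion ↥(maximalRealSubfield L))] [νv.IsAddHaarMeasure] in
/-- **THE 𝔫-BALL HAS FINITE VOLUME** (inside the compact `𝒪_v³`). [cite: TateThesis1967, §3.3] -/
theorem levelBall_measure_lt_top [BorelSpace (v.adicCompletion ↥(maximalRealSubfield L))] [νv.IsAddHaarMeasure] :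
    (Measure.pi fun _ : Fin 3 => νv) {p : Fin 3 → v.adicCompletion ↥(maximalRealSubfield L) | p ∈ integralBox ↥(maximalRealSubfield L) (Fin 3) v ∧ ∀ w' : PlacesOver L v,
      Valued.v (quadraticLocalEquiv L v (IsCMField.complexConj L) hcδ hδ (p 0, p 1) w') ≤ idealRadius L w'.1 𝔫 ∧
      Valued.v (conjLocal L (IsCMField.complexConj L) v (quadraticLocalEquiv L v (IsCMField.complexConj L) hcδ hδ (p 0, p 1)) w') ≤ idealRadius L w'.1 𝔫 ∧
      Valued.v ((toLocalRing L v (p 2) * algebraMap L (LocalRing L v) δ -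
        toLocalRing L v 2⁻¹ * (quadraticLocalEquiv L v (IsCMField.complexConj L) hcδ hδ (p 0, p 1) * conjLocal L (IsCMField.complexConj L) v (quadraticLocalEquiv L v (IsCMField.complexConj L) hcδ hδ (p 0, p 1)))) w') ≤ idealRadius L w'.1 𝔫} < ⊤ := by
  haveI : SecondCountableTopology (v.adicCompletion ↥(maximalRealSubfield L)) := secondCountableTopology_localField _
  exact lt_of_le_of_lt (measure_mono (levelBall_subset_integralBox L hcδ hδ v 𝔫)) (isCompact_integralBox ↥(maximalRealSubfield L) (Fin 3) v).measure_lt_top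

end Measure

/-! ## §2 HEAD: ★ F5's `hA32` at the moved base point -/

section Head

variable [∀ v : HeightOneSpectrum (𝓞 ↥(maximalRealSubfield L)), MeasurableSpace (v.adicCompletion ↥(maximalRealSubfield L))] [∀ v : HeightOneSpectrum (𝓞 ↥(maximalRealSubfield L)), BorelSpace (v.adicCompletion ↥(maximalRealSubfield L))]
  (νv : ∀ v : HeightOneSpectrum (𝓞 ↥(maximalRealSubfield L)), Measure (v.adicCompletion ↥(maximalRealSubfield L))) [∀ v, (νv v).IsAddHaarMeasure]
  [MeasurableSpace (InfiniteAdeleRing L)] [BorelSpace (InfiniteAdeleRing L)]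
  [MeasurableSpace (InfiniteAdeleRing ↥(maximalRealSubfield L))] [BorelSpace (InfiniteAdeleRing ↥(maximalRealSubfield L))]
  (μE₁ : Measure (InfiniteAdeleRing L)) [μE₁.IsAddHaarMeasure] (μF₁ : Measure (InfiniteAdeleRing ↥(maximalRealSubfield L))) [μF₁.IsAddHaarMeasure]

include hcδ hδ in
/-- **HEAD.  ★ F5's `hA32` FOR THE AMPLITUDE OF RECORD READ AT THE MOVED BASE POINT `ι_f(w₀^{S₀})`** — the fully named
`A z := (C·∏_{v∈S₀} ν_v(𝒪_v³)⁻¹ • ∫ 𝟙_{B_v(𝔫)}·Q_v^{−z}) · ∫_{L_∞}∫_{L⁺_∞} (u·∏_w archUnitaryValue (m_w) 0 ζ_w)·ARCH₃^{−z}` with the 𝔫-BALL TEST WEIGHTS at the bad places: `A (3 / 2) ≠ 0`, from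
★ p864169 `hA32_of_record_of_testWeights` and §1 (every `B_v(𝔫)` is measurable of positive finite volume with `Q_v = 1` on it; `c_v := 1`).  Visible letters exactly: the coupling
range `hm`, the unit `hu`, the Haar constant `hC`; no hypothesis on `𝔫` (the identification with the witness's weights, which wants `𝔫` divisible by every place of `S₀`, is the
unfolding row's). [cite: MoeglinWaldspurger1995, II.1.7, IV.1.11] [cite: Rogawski1990, §13.9 p. 229] [cite: Casselman1980, §3] -/
theorem hA32_of_record_at_basePoint (m : InfinitePlace L → ℤ) (hm : ∀ w, |m w| ≤ 2) (u : ℂ) (hu : u ≠ 0)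
    (S₀ : Finset (HeightOneSpectrum (𝓞 ↥(maximalRealSubfield L)))) {C : ℂ} (hC : C ≠ 0) :
    (fun z : ℂ => (C * ∏ v ∈ S₀, ((Measure.pi fun _ : Fin 3 => νv v) (integralBox ↥(maximalRealSubfield L) (Fin 3) v)).toReal⁻¹ •
        ∫ p : Fin 3 → v.adicCompletion ↥(maximalRealSubfield L),
          Set.indicator {p : Fin 3 → v.adicCompletion ↥(maximalRealSubfield L) | p ∈ integralBox ↥(maximalRealSubfield L) (Fin 3) v ∧ ∀ w' : PlacesOver L v,
              Valued.v (quadraticLocalEquiv L v (IsCMField.complexConj L) hcδ hδ (p 0, p 1) w') ≤ idealRadius L w'.1 𝔫 ∧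
              Valued.v (conjLocal L (IsCMField.complexConj L) v (quadraticLocalEquiv L v (IsCMField.complexConj L) hcδ hδ (p 0, p 1)) w') ≤ idealRadius L w'.1 𝔫 ∧
              Valued.v ((toLocalRing L v (p 2) * algebraMap L (LocalRing L v) δ -
                toLocalRing L v 2⁻¹ * (quadraticLocalEquiv L v (IsCMField.complexConj L) hcδ hδ (p 0, p 1) * conjLocal L (IsCMField.complexConj L) v (quadraticLocalEquiv L v (IsCMField.complexConj L) hcδ hδ (p 0, p 1)))) w') ≤ idealRadius L w'.1 𝔫}
            (fun _ => (1 : ℂ)) p *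
          (((∏ w' : PlacesOver L v, max 1 (max ((normAbs (w'.1.adicCompletion L) (quadraticLocalEquiv L v (IsCMField.complexConj L) hcδ hδ (p 0, p 1) w') : ℝ≥0) : ℝ)
            ((normAbs (w'.1.adicCompletion L) ((toLocalRing L v (p 2) * algebraMap L (LocalRing L v) δ -
              toLocalRing L v 2⁻¹ * (quadraticLocalEquiv L v (IsCMField.complexConj L) hcδ hδ (p 0, p 1) *
                conjLocal L (IsCMField.complexConj L) v (quadraticLocalEquiv L v (IsCMField.complexConj L) hcδ hδ (p 0, p 1)))) w') : ℝ≥0) : ℝ))) : ℝ) : ℂ) ^ (-z) ∂(Measure.pi fun _ : Fin 3 => νv v)) *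
      ∫ Xi : InfiniteAdeleRing L, ∫ a : InfiniteAdeleRing ↥(maximalRealSubfield L),
      (u * ∏ w : InfinitePlace L, archUnitaryValue (m w) 0 ((((-(1 + ‖Xi w‖ ^ 2 / 2)) : ℝ) : ℂ) +
          (((w.embedding δ).im * ((InfiniteAdeleRing.ringEquiv_mixedSpace ↥(maximalRealSubfield L)) a).1 ⟨w.comap (algebraMap ↥(maximalRealSubfield L) L), K2E1HeightBigCellLineFormulaU2.isReal_comap_maximalRealSubfield L w⟩ : ℝ) : ℂ) * Complex.I)) *
        ((((∏ w : InfinitePlace L, ((1 + ‖(Xi) w‖ ^ 2 / 2) ^ 2 + (w δ) ^ 2 * (((InfiniteAdeleRing.ringEquiv_mixedSpace ↥(maximalRealSubfield L)) a).1 ⟨w.comap (algebraMap ↥(maximalRealSubfield L) L), K2E1HeightBigCellLineFormulaU2.isReal_comap_maximalRealSubfield L w⟩) ^ 2))) : ℝ) : ℂ) ^ (-z) ∂μF₁ ∂μE₁) (3 / 2) ≠ 0 :=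
  hA32_of_record_of_testWeights L hcδ hδ νv μE₁ μF₁ m hm u hu S₀
    (fun v => {p : Fin 3 → v.adicCompletion ↥(maximalRealSubfield L) | p ∈ integralBox ↥(maximalRealSubfield L) (Fin 3) v ∧ ∀ w' : PlacesOver L v,
              Valued.v (quadraticLocalEquiv L v (IsCMField.complexConj L) hcδ hδ (p 0, p 1) w') ≤ idealRadius L w'.1 𝔫 ∧
              Valued.v (conjLocal L (IsCMField.complexConj L) v (quadraticLocalEquiv L v (IsCMField.complexConj L) hcδ hδ (p 0, p 1)) w') ≤ idealRadius L w'.1 𝔫 ∧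
              Valued.v ((toLocalRing L v (p 2) * algebraMap L (LocalRing L v) δ -
                toLocalRing L v 2⁻¹ * (quadraticLocalEquiv L v (IsCMField.complexConj L) hcδ hδ (p 0, p 1) * conjLocal L (IsCMField.complexConj L) v (quadraticLocalEquiv L v (IsCMField.complexConj L) hcδ hδ (p 0, p 1)))) w') ≤ idealRadius L w'.1 𝔫})
    (fun v _ => measurableSet_levelBall L hcδ hδ v 𝔫) (fun v _ => levelBall_measure_pos L hcδ hδ v 𝔫 (νv v)) (fun v _ => levelBall_measure_lt_top L hcδ hδ v 𝔫 (νv v))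
    (fun v _ _ hp => localHeight_eq_one_of_mem_levelBall L hcδ hδ v 𝔫 hp) (fun _ => (1 : ℂ)) (fun _ _ => one_ne_zero) _
    (fun _ _ _ hp => Set.indicator_of_mem hp _) (fun _ _ _ hp => Set.indicator_of_notMem hp _) hC

end Head

end Summit.HodgeConjecture.HodgeConjecture.Cruxes.H413.K2E1ChiArchA32MovedBasePointU3

end
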